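import Summits.ValiantsHypothesis.ValiantsHypothesis.Theorems.VPBoundarySquareTrdeg
import Literature.Computability.AlgebraicComplexity.ArithCircuitCodeBounds
import Literature.Computability.AlgebraicComplexity.CircuitDepth
import HarnessLib

/-!
# VPBoundarySquare — the DEGREE METHOD for border complexity, and an explicit family outside
`\overline{VP}^ℂ` with ONE field generator (decomp-valiant lens 3, NODE v9, theorem T4)

Context: items 24721 `CHClosureDefinable` (= U_CH) and 24720 (= U_nb) of route `VPBoundarySquare`.
NODE v9 booked two unconditional consequences of U_CH for `\overline{VP}^ℂ`: the transcendence degree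
of the coefficient field of a `\overline{VP}` p-family is p-bounded (`VPBoundarySquareTrdeg`, T1) and all
its coefficients lie in a field with p(n) generators (`VPBoundarySquareFewConstants`, T2). The critic
(ruling R4) rightly objected that the COUNT of constants is not the content of U_CH — the FORMAT is
(integer polynomials of exponential format with CH-definable coefficients, evaluated at few constants).
This file proves the next unconditional consequence in the FORMAT direction — the DEGREE format — by
transferring Baur–Strassen's degree method (BCS Thm. (9.3)) from exact to BORDER complexity:

* `degreeMethod`, `degreeMethod_of_approxComplexity_le`: if `\underline{L}(f) ≤ r` (`f ∈ ℂ[x_σ]`) and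
  the power products `∏ i, (coeff_{c i} f)^{j i}` (`j i < δ i`) are linearly independent over `ℚ`, then
  `∏ i, δ i ≤ (2^{a} · Σ_i (δ i − 1) + 1)^{m}` with `a = 2N(8N+1)`, `N = #σ + 2r + 1`,
  `m = paramCount(#σ, r)` — so `log ∏ δ_i = poly(#σ, r, log Σ δ_i)`: the coefficients of a border family
  admit only "polynomially much" multiplicative independence, which is what coefficients of the form
  `Q_n(κ_n)` with `deg Q_n ≤ 2^{poly(n)}` and `poly(n)` constants `κ_n` (U_CH's format) satisfy.
* (sequel file `VPBoundarySquareTowerFamily`) `not_isVPBarFamily_towerFamily`: the multilinear tower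
  family `g_n(t) = Σ_{S ⊆ [n]} t^{2^{bin S}} x^S` is NOT in `\overline{VP}^ℂ` for transcendental `t`,
  although its coefficient field is `ℚ(t)` (one generator) — border analogue of BCS Cor. (9.4).

Mechanism. Over `ℚ`, the coefficient polynomials `H_d ∈ ℚ[y_Par]` of the affine specialisation `Φ_N`
of Malod's generic computation `G_N` have total degree `≤ deg G_N ≤ 2^{2N(8N+1)}`
(`totalDegree_coeffPoly_le`, `totalDegree_genericComputation_le` — via the landed `2^{#wires}` degree
bound for circuits and the fan-in-two size `N(8N+1)` of Malod's circuit). The power products of the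
`H_{c i}` with exponent pattern `j < δ` are polynomials of degree `≤ T = deg G_N · Σ(δ_i − 1)` in
`m = #Par` variables; extracting the coefficients at exponent vectors `≤ T` maps them linearly into a
`ℚ`-space of dimension `(T+1)^m`, so if `∏ δ_i > (T+1)^m` they are linearly dependent; a dependency
`Σ_j a_j H^j = 0` is a polynomial identity `R(H) = 0` (`R = Σ_j a_j Y^j ≠ 0`-free argument: we only use the
coefficients `a_j`), hence `R(coeff Φ_N(γ)) = 0` on the image, hence on its ZARISKI CLOSURE
(`aeval_coeff_eq_zero_of_rel` — the closure costs nothing because the method is an identity on the image),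
contradicting the independence of the power products of the `coeff_{c i} f`.

Honest scope: no statement of record, split or `closes` changes; nothing here bears on `VP ≠ VNP`
(the tower family is not in `VNP^ℂ` either: its coefficients have superpolynomial degree in `t`); U_CH
itself (FORMAT in full + DEFINABILITY) stays open, as does even `\overline{VP}^ℂ ⊆ VPSPACE^ℂ`. Ladder
bookkeeping for NODE v9: U_CH ⟺ FEW-CONSTANTS (✓ T2) ∧ FORMAT (degree consequence ✓ T4; height/exp-format
consequence open) ∧ DEFINABILITY (open). 0 sorry.

Sources: Bürgisser–Clausen–Shokrollahi 1997, §9.1 (generic computation, `deg F_{rν} ≤ 1 + rν`),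
Thm. (9.3) (Baur's degree method), Cor. (9.4) (`Σ √p_ν X^ν`) [corpus chunks p0244–p0247];
approximation / closure vocabulary: Bürgisser–Landsberg–Manivel–Weyman 2011, Def. 9.3.1; Malod's
generic computation and its circuit: Bürgisser 2024, §4.2.
-/

noncomputable section

set_option linter.dupNamespace false

open MvPolynomial
open Literature.Computability.AlgebraicComplexity

namespace Summit.ValiantsHypothesis.ValiantsHypothesis.Theorems.VPBoundarySquareDegree

open Summit.ValiantsHypothesis.ValiantsHypothesis.Theorems.VPBoundarySquareTrdeg

variable {σ : Type} [Fintype σ]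

/-! ### Coefficient degrees of polynomials over a polynomial ring -/

section CoeffDeg

variable {P : Type}

/-! We write "`F` has coefficient degrees `≤ D`" for `∀ d, (coeff d F).totalDegree ≤ D`
(`F ∈ (ℚ[y_P])[x_σ]`, degrees in the parameters `y`). -/

omit [Fintype σ] in
/-- Sums. [folklore] -/
theorem cdeg_add {D : ℕ} {F G : MvPolynomial σ (MvPolynomial P ℚ)} (hF : ∀ d, (coeff d F).totalDegree ≤ D)
    (hG : ∀ d, (coeff d G).totalDegree ≤ D) : ∀ d, (coeff d (F + G)).totalDegree ≤ D := fun d => by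
  rw [coeff_add]
  exact (totalDegree_add _ _).trans (max_le (hF d) (hG d))

omit [Fintype σ] in
/-- Finite sums. [folklore] -/
theorem cdeg_sum {ι : Type} (s : Finset ι) {D : ℕ} {F : ι → MvPolynomial σ (MvPolynomial P ℚ)}
    (h : ∀ i ∈ s, ∀ d, (coeff d (F i)).totalDegree ≤ D) : ∀ d, (coeff d (∑ i ∈ s, F i)).totalDegree ≤ D := by
  classical
  induction s using Finset.induction_on with
  | empty => intro d; simp
  | insert a s ha ih =>
    rw [Finset.sum_insert ha]
    exact cdeg_add (h a (Finset.mem_insert_self a s)) (ih fun i hi => h i (Finset.mem_insert_of_mem hi))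

omit [Fintype σ] in
/-- Products add the bounds. [folklore] -/
theorem cdeg_mul {D₁ D₂ : ℕ} {F G : MvPolynomial σ (MvPolynomial P ℚ)} (hF : ∀ d, (coeff d F).totalDegree ≤ D₁)
    (hG : ∀ d, (coeff d G).totalDegree ≤ D₂) : ∀ d, (coeff d (F * G)).totalDegree ≤ D₁ + D₂ := fun d => by
  classical
  rw [coeff_mul]
  refine (totalDegree_finsetSum _ _).trans (Finset.sup_le fun x _ => ?_)
  exact (totalDegree_mul _ _).trans (add_le_add (hF x.1) (hG x.2))

omit [Fintype σ] in
/-- Constants `C a` have coefficient degrees `≤ deg a`. [folklore] -/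
theorem cdeg_C (a : MvPolynomial P ℚ) : ∀ d, (coeff d (C a : MvPolynomial σ (MvPolynomial P ℚ))).totalDegree ≤ a.totalDegree :=
  fun d => by
  classical
  rw [coeff_C]
  split_ifs <;> simp

omit [Fintype σ] in
/-- `1` has coefficient degrees `≤ 0`. [folklore] -/
theorem cdeg_one : ∀ d, (coeff d (1 : MvPolynomial σ (MvPolynomial P ℚ))).totalDegree ≤ 0 := by
  simpa using cdeg_C (σ := σ) (P := P) 1

omit [Fintype σ] in
/-- Variables `X x` have coefficient degrees `≤ 0`. [folklore] -/
theorem cdeg_X (x : σ) : ∀ d, (coeff d (X x : MvPolynomial σ (MvPolynomial P ℚ))).totalDegree ≤ 0 := fun d => by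
  classical
  rw [X, coeff_monomial]
  split_ifs <;> simp

omit [Fintype σ] in
/-- Powers multiply the bound. [folklore] -/
theorem cdeg_pow {D : ℕ} {F : MvPolynomial σ (MvPolynomial P ℚ)} (hF : ∀ d, (coeff d F).totalDegree ≤ D) :
    ∀ n : ℕ, ∀ d, (coeff d (F ^ n)).totalDegree ≤ n * D
  | 0 => by simpa using (cdeg_one (σ := σ) (P := P))
  | n + 1 => by
    rw [pow_succ, add_mul, one_mul]
    exact cdeg_mul (cdeg_pow hF n) hF

omit [Fintype σ] in
/-- Finite products add the bounds. [folklore] -/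
theorem cdeg_prod {ι : Type} (s : Finset ι) {D : ι → ℕ} {F : ι → MvPolynomial σ (MvPolynomial P ℚ)}
    (h : ∀ i ∈ s, ∀ d, (coeff d (F i)).totalDegree ≤ D i) :
    ∀ d, (coeff d (∏ i ∈ s, F i)).totalDegree ≤ ∑ i ∈ s, D i := by
  classical
  induction s using Finset.induction_on with
  | empty => rw [Finset.sum_empty, Finset.prod_empty]; exact cdeg_one
  | insert a s ha ih =>
    rw [Finset.sum_insert ha, Finset.prod_insert ha]
    exact cdeg_mul (h a (Finset.mem_insert_self a s)) (ih fun i hi => h i (Finset.mem_insert_of_mem hi))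

omit [Fintype σ] in
/-- **Substituting parameter-degree-`≤ 1` data into `G` gives coefficient degrees `≤ deg G`.** [folklore] -/
theorem cdeg_aeval {ι : Type} (θ : ι → MvPolynomial σ (MvPolynomial P ℚ))
    (hθ : ∀ i d, (coeff d (θ i)).totalDegree ≤ 1) (G : MvPolynomial ι ℚ) :
    ∀ d, (coeff d (aeval θ G)).totalDegree ≤ G.totalDegree := by
  classical
  have hsum : aeval θ G = ∑ a ∈ G.support, aeval θ (monomial a (coeff a G)) := by
    conv_lhs => rw [G.as_sum]
    rw [map_sum]
  rw [hsum]
  refine cdeg_sum _ fun a ha => ?_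
  rw [aeval_monomial, MvPolynomial.algebraMap_apply, MvPolynomial.algebraMap_eq]
  have h1 : ∀ d, (coeff d (C (C (coeff a G)) : MvPolynomial σ (MvPolynomial P ℚ))).totalDegree ≤ 0 := by
    simpa using cdeg_C (σ := σ) (C (coeff a G) : MvPolynomial P ℚ)
  have h2 : ∀ d, (coeff d (a.prod fun i e => θ i ^ e)).totalDegree ≤ ∑ i ∈ a.support, a i * 1 :=
    cdeg_prod _ fun i _ => cdeg_pow (hθ i) (a i)
  have h3 := cdeg_mul h1 h2
  rw [zero_add] at h3
  intro d
  refine (h3 d).trans ?_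
  simpa [Finsupp.sum] using le_totalDegree ha

end CoeffDeg

/-! ### Degree of the coefficient polynomials `H_d` of `Φ_N` -/

/-- The affine forms `Σ_x γ(i,x)·x + γ(i)` have parameter degree `≤ 1`. [folklore] -/
theorem cdeg_affSpec (N : ℕ) (i : MalodGeneric.Var N) :
    ∀ d, (coeff d (affSpec (σ := σ) N (fun p => (X p : MvPolynomial (Par N σ) ℚ)) i)).totalDegree ≤ 1 := by
  classical
  unfold affSpec
  refine cdeg_add (cdeg_sum _ fun x _ => ?_) ?_
  · have := cdeg_mul (cdeg_C (σ := σ) (X (i, some x) : MvPolynomial (Par N σ) ℚ)) (cdeg_X x)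
    simpa using this
  · simpa using cdeg_C (σ := σ) (X (i, none) : MvPolynomial (Par N σ) ℚ)

/-- **`deg H_d ≤ deg G_N`**: every coefficient polynomial of the affine specialisation of Malod's
generic computation has total degree at most the total degree of `G_N`.
[cite: BurgisserClausenShokrollahi1997, §9.1 (`deg F_{rν} ≤ 1 + rν`)] -/
theorem totalDegree_coeffPoly_le (N : ℕ) (d : σ →₀ ℕ) :
    (coeffPoly (σ := σ) N d).totalDegree ≤ (MalodGeneric.genericComputation ℚ N).totalDegree :=
  cdeg_aeval _ (cdeg_affSpec N) _ d

/-- **`deg G_N ≤ 2^{2N(8N+1)}`** (the generic computation is computed by a fan-in-two circuit of size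
`N(8N+1)`, and a circuit with `e` wires computes a polynomial of degree `≤ 2^e`).
[cite: Burgisser2024Completeness, §4.2 (p0016 L50–L51)] -/
theorem totalDegree_genericComputation_le (N : ℕ) :
    (MalodGeneric.genericComputation ℚ N).totalDegree ≤ 2 ^ (2 * (N * (8 * N + 1))) := by
  have hc : (MalodGeneric.circuit ℚ N).eval = MalodGeneric.genericComputation ℚ N :=
    MalodGeneric.circuit_computes ℚ N
  rw [← hc]
  refine (ArithCircuit.totalDegree_eval_le_two_pow_edgeSize _).trans (Nat.pow_le_pow_right two_pos ?_)
  have := ArithCircuit.edgeSize_le_two_mul_size_holds (MalodGeneric.circuit_isFanInTwo ℚ N)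
  rw [MalodGeneric.circuit_size] at this
  exact this

/-! ### Rational relations among the `H_d` transfer to the Zariski closure of `im Φ_N` -/

/-- **Transfer of relations.** If `coeff f` lies in the Zariski closure of `im Φ_N` and a rational
polynomial `R` annihilates the coefficient polynomials `H_{c i}`, then `R` vanishes at the
corresponding coefficients of `f`. [cite: BurgisserClausenShokrollahi1997, Thm. (9.3) (§9.1, proof)] -/
theorem aeval_coeff_eq_zero_of_rel {N : ℕ} {f : MvPolynomial σ ℂ}
    (hf : coeffVec f ∈ zariskiClosure (coeffVec '' Set.range (phi (σ := σ) N)))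
    {ι : Type} (c : ι → (σ →₀ ℕ)) (R : MvPolynomial ι ℚ)
    (hR : aeval (fun j => coeffPoly (σ := σ) N (c j)) R = 0) :
    aeval (fun j => coeff (c j) f) R = 0 := by
  -- the test polynomial `R(z_{c j})` on coefficient space
  let p : MvPolynomial (σ →₀ ℕ) ℂ := aeval (fun j => (X (c j) : MvPolynomial (σ →₀ ℕ) ℂ)) R
  have hev : ∀ y : (σ →₀ ℕ) → ℂ, aeval y p = aeval (fun j => y (c j)) R := by
    intro y
    show ((aeval y).restrictScalars ℚ) (aeval _ R) = _
    rw [← AlgHom.comp_apply, MvPolynomial.comp_aeval]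
    have : (fun i => ((aeval y).restrictScalars ℚ) (X (c i) : MvPolynomial (σ →₀ ℕ) ℂ)) =
        fun j => y (c j) := by
      funext j
      simp
    rw [this]
  have hp : ∀ y ∈ coeffVec '' Set.range (phi (σ := σ) N), aeval y p = 0 := by
    rintro _ ⟨g, ⟨γ, rfl⟩, rfl⟩
    rw [hev]
    have : (fun j => coeffVec (phi N γ) (c j)) = fun j => (aeval γ) (coeffPoly (σ := σ) N (c j)) := by
      funext j
      exact coeff_phi N γ (c j)
    rw [this, ← MvPolynomial.comp_aeval, AlgHom.comp_apply, hR, map_zero]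
  have key := (mem_zariskiClosure_iff.mp hf) p hp
  rwa [hev] at key

/-! ### The degree method (Baur; BCS Thm. 9.3) for the closure -/

/-- **DEGREE METHOD for the Zariski closure of `im Φ_N`** (Baur's refinement of Strassen's degree
bound, BCS Thm. (9.3), transferred verbatim to border complexity): if `coeff f ∈ closure(im Φ_N)` and,
for finitely many coefficients `c i` of `f` and bounds `δ i`, the power products
`∏ i, (coeff (c i) f)^{j i}` (`j i < δ i`) are linearly independent over `ℚ`, then
`∏ i, δ i ≤ (D·Σ i (δ i − 1) + 1)^{#Par(N)}` where `D = deg G_N`. (Mechanism: otherwise the power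
products of the `H_{c i}` — polynomials of degree `≤ D·Σ(δ i − 1)` in `#Par` parameters — are more
numerous than the monomials available, hence satisfy a nontrivial rational linear relation, which is a
polynomial identity on `im Φ_N` and so persists on the closure.)
[cite: BurgisserClausenShokrollahi1997, Thm. (9.3) (§9.1)] -/
theorem degreeMethod {N : ℕ} {f : MvPolynomial σ ℂ}
    (hf : coeffVec f ∈ zariskiClosure (coeffVec '' Set.range (phi (σ := σ) N)))
    {ι : Type} [Fintype ι] (c : ι → (σ →₀ ℕ)) (δ : ι → ℕ)
    (hind : LinearIndependent ℚ fun j : (∀ i, Fin (δ i)) => ∏ i, coeff (c i) f ^ ((j i : ℕ))) :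
    ∏ i, δ i ≤ ((MalodGeneric.genericComputation ℚ N).totalDegree * (∑ i, (δ i - 1)) + 1) ^
      Fintype.card (Par N σ) := by
  classical
  set D := (MalodGeneric.genericComputation ℚ N).totalDegree with hD
  set T := D * ∑ i, (δ i - 1) with hT
  -- the power products of the coefficient polynomials and their degree
  let Pj : (∀ i, Fin (δ i)) → MvPolynomial (Par N σ) ℚ := fun j => ∏ i, coeffPoly (σ := σ) N (c i) ^ (j i : ℕ)
  have hdegP : ∀ j, (Pj j).totalDegree ≤ T := by
    intro j
    refine (totalDegree_finsetProd _ _).trans ?_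
    calc ∑ i, (coeffPoly (σ := σ) N (c i) ^ (j i : ℕ)).totalDegree
        ≤ ∑ i, (δ i - 1) * D := Finset.sum_le_sum fun i _ => (totalDegree_pow _ _).trans
            (Nat.mul_le_mul (Nat.le_sub_one_of_lt (j i).2) (totalDegree_coeffPoly_le N (c i)))
      _ = T := by rw [hT, ← Finset.sum_mul, mul_comm]
  -- exponent vectors with all entries `≤ T`, and the coefficient-extraction map
  let E : Type := Par N σ → Fin (T + 1)
  let toF : E → (Par N σ →₀ ℕ) := fun g => Finsupp.equivFunOnFinite.symm fun p => (g p : ℕ)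
  let Λ : MvPolynomial (Par N σ) ℚ →ₗ[ℚ] (E → ℚ) :=
    { toFun := fun q g => coeff (toF g) q
      map_add' := fun q q' => by funext g; simp
      map_smul' := fun a q => by funext g; simp [coeff_smul] }
  -- a polynomial of degree `≤ T` killed by `Λ` is zero
  have hΛ : ∀ q : MvPolynomial (Par N σ) ℚ, q.totalDegree ≤ T → Λ q = 0 → q = 0 := by
    intro q hq h0
    ext e
    rw [coeff_zero]
    by_cases he : e ∈ q.support
    · have hle : ∀ p, e p ≤ T := by
        intro p
        refine le_trans ?_ ((le_totalDegree he).trans hq)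
        by_cases hp : p ∈ e.support
        · exact Finset.single_le_sum (fun _ _ => Nat.zero_le _) hp
        · rw [Finsupp.notMem_support_iff.mp hp]; exact Nat.zero_le _
      have : toF (fun p => ⟨e p, Nat.lt_succ_of_le (hle p)⟩) = e := by
        ext p; simp [toF]
      have h1 := congrFun h0 (fun p => ⟨e p, Nat.lt_succ_of_le (hle p)⟩)
      simpa [Λ, this] using h1
    · exact notMem_support_iff.mp he
  by_contra hlt
  push Not at hlt
  -- too many power products: the family `Λ ∘ Pj` in `E → ℚ` is linearly dependent
  have hdep : ¬ LinearIndependent ℚ (fun j => Λ (Pj j)) := by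
    intro hli
    have h := hli.fintype_card_le_finrank
    rw [Module.finrank_fintype_fun_eq_card, Fintype.card_pi] at h
    simp only [Fintype.card_fin, E, Fintype.card_fun] at h
    exact absurd h (not_le.mpr hlt)
  obtain ⟨a, ha0, j₀, hj₀⟩ := Fintype.not_linearIndependent_iff.mp hdep
  -- hence `Σ a_j Pj j = 0` in `ℚ[y_Par]`
  have hsum0 : ∑ j, a j • Pj j = 0 := by
    refine hΛ _ ?_ ?_
    · refine (totalDegree_finsetSum _ _).trans (Finset.sup_le fun j _ => ?_)
      exact (totalDegree_smul_le _ _).trans (hdegP j)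
    · rw [map_sum]
      simpa only [map_smul] using ha0
  -- the relation polynomial `R = Σ_j a_j Y^j`
  let R : MvPolynomial ι ℚ := ∑ j, monomial (Finsupp.equivFunOnFinite.symm fun i => (j i : ℕ)) (a j)
  have hRaeval : ∀ {A : Type} [CommRing A] [Algebra ℚ A] (y : ι → A),
      aeval y R = ∑ j, a j • ∏ i, y i ^ (j i : ℕ) := by
    intro A _ _ y
    simp only [R, map_sum, aeval_monomial, Algebra.smul_def]
    refine Finset.sum_congr rfl fun j _ => ?_
    congr 1
    rw [Finsupp.prod_fintype _ _ fun i => pow_zero _]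
    simp
  have hRH : aeval (fun i => coeffPoly (σ := σ) N (c i)) R = 0 := by
    rw [hRaeval]; exact hsum0
  have key := aeval_coeff_eq_zero_of_rel hf c R hRH
  rw [hRaeval] at key
  exact hj₀ (Fintype.linearIndependent_iff.mp hind a key j₀)

/-- **DEGREE METHOD for border complexity** `\underline{L}(f) ≤ r` (`f ∈ ℂ[x_σ]`): if the power
products `∏ i, (coeff (c i) f)^{j i}` (`j i < δ i`) are linearly independent over `ℚ` then
`∏ i, δ i ≤ (2^{2N(8N+1)} · Σ i (δ i − 1) + 1)^{paramCount(#σ, r)}` with `N = #σ + 2r + 1`.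
Border analogue of BCS Thm. (9.3) / Cor. (9.4) (there for EXACT complexity); the closure costs nothing
because the argument is a polynomial identity on the image of the generic computation.
[cite: BurgisserClausenShokrollahi1997, Thm. (9.3) (§9.1)] [cite: BurgisserEtAl2011, Def. 9.3.1] -/
theorem degreeMethod_of_approxComplexity_le [DecidableEq σ] (f : MvPolynomial σ ℂ) {r : ℕ}
    (hr : approxComplexity f ≤ r) {ι : Type} [Fintype ι] (c : ι → (σ →₀ ℕ)) (δ : ι → ℕ)
    (hind : LinearIndependent ℚ fun j : (∀ i, Fin (δ i)) => ∏ i, coeff (c i) f ^ ((j i : ℕ))) :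
    ∏ i, δ i ≤ (2 ^ (2 * ((Fintype.card σ + 2 * r + 1) * (8 * (Fintype.card σ + 2 * r + 1) + 1))) *
      (∑ i, (δ i - 1)) + 1) ^ paramCount (Fintype.card σ) r := by
  have h0 := coeffVec_mem_zariskiClosure_approxComplexity f
  have h1 : coeffVec f ∈ zariskiClosure
      (⋃ s ∈ Finset.range (r + 1), coeffVec '' Set.range (phi (σ := σ) (Fintype.card σ + 2 * s + 1))) :=
    zariskiClosure_mono ((Set.image_mono fun g (hg : complexity g ≤ approxComplexity f) =>
      hg.trans hr).trans (coeffVec_image_subset r)) h0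
  obtain ⟨s, hs, hmem⟩ := mem_zariskiClosure_biUnion _ _ h1
  have hsr : s ≤ r := by simpa [Finset.mem_range, Nat.lt_succ_iff] using hs
  refine (degreeMethod hmem c δ hind).trans ?_
  rw [card_par]
  refine (Nat.pow_le_pow_left ?_ _).trans (Nat.pow_le_pow_right ?_ (paramCount_mono _ hsr))
  · refine Nat.add_le_add_right (Nat.mul_le_mul_right _ ((totalDegree_genericComputation_le _).trans
      (Nat.pow_le_pow_right two_pos ?_))) 1
    have : Fintype.card σ + 2 * s + 1 ≤ Fintype.card σ + 2 * r + 1 := by omega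
    exact Nat.mul_le_mul_left 2 (Nat.mul_le_mul this (by omega))
  · exact Nat.succ_pos _

end Summit.ValiantsHypothesis.ValiantsHypothesis.Theorems.VPBoundarySquareDegree

end
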